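import Summits.NavierStokesRegularity.FluidComputer.HomSobolev32Clock
import Summits.NavierStokesRegularity.FluidComputer.SuperLadder
import HarnessLib

/-!
# Fluid computer — L54 in the printed currency: `‖u(t)‖_{Ḣ^σ} ≳ ν^{σ/3} ‖u(0)‖₂^{(3−2σ)/3} (T − t)^{−σ/3}`, every `σ > 3/2`

HONEST FRAMING (cell `pub-fluidc`, verbatim): *low prior, high value-of-information experiment on Tao's
machine paradigm; NOT a claim that NS blows up.* Theorem side of the cell (the level dictionary); nothing here is
evidence of blow-up.

The super-ladder L54 (`SuperLadder.superLadder_clock`) bounds the DYADIC rows `∑_j 4^{σj} ‖Δ̇_j u(t)‖₂²`, `σ > 3/2`,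
from below by `κ_σ ν^{2σ/3} ‖u(0)‖₂^{−(4σ−6)/3} (T − t)^{−2σ/3}` — Benameur's printed shape, but in dyadic currency. With
`Ḃ^σ_{2,2} = Ḣ^σ` (`LittlewoodPaleySobolevSquareFunction`, carried to vector fields in
`HomSobolev32Clock.tsum_weight_blockL2_sq_le`) the same holds for the Fourier-side seminorm `‖u(t)‖_{Ḣ^σ}`:

* `homSobolev_superLadder_clock_sq` (**L54 IN `Ḣ^σ`, squared**) — for every `σ > 3/2` one `κ > 0` with
  `κ ν^{2σ/3} (T − t)^{−2σ/3} ≤ ‖u(0)‖₂^{(4σ−6)/3} · ‖u(t)‖²_{Ḣ^σ}` at every `t ∈ (0, T)`;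
* `homSobolev_superLadder_tendsto_top` — `‖u(t)‖_{Ḣ^σ} → ∞` as `t ↑ T` for every `σ > 3/2` (so, with L27′/L52′/L57′,
  for EVERY `σ ≥ 1/2`).

HONEST: the exponent `σ/3` (for the norm) is Benameur's, NOT the optimal `(2σ−1)/4` of Robinson–Sadowski–Silva for
`σ < 5/2`; the energy factor is explicit. 0 sorry; no definitions; no named facts.

## References

* J. Benameur, *On the blow-up criterion of 3D Navier–Stokes equations*, J. Math. Anal. Appl. 371 (2010) 719–727,
  Thm. 1.1. [Benameur2010]
* H. Bahouri, J.-Y. Chemin, R. Danchin, Grundlehren 343 (2011), §2.3 (`Ḃ^s_{2,2} = Ḣ^s`). [BahouriCheminDanchin2011]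
-/

noncomputable section

open MeasureTheory Set Function Filter Topology
open scoped ENNReal NNReal
open Literature.Analysis.FluidPDE Literature.Analysis.FunctionSpaces
open Summit.NavierStokesRegularity.FluidComputer.HomSobolev32Clock
open Summit.NavierStokesRegularity.FluidComputer.SuperLadder

namespace Summit.NavierStokesRegularity.FluidComputer.HomSobolevSuperLadder

/-- **L54 IN THE `Ḣ^σ` CURRENCY (squared form).** For every `σ > 3/2` there is `κ = κ_σ > 0` such that for every
`ν > 0`, `T > 0`, every maximal smooth solution `(u, p)` of the unforced Navier–Stokes system on `ℝ³ × [0, T)` which is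
Leray–Hopf from `u 0`, and EVERY `t ∈ (0, T)`:
`κ · ν^{2σ/3} · (T − t)^{−2σ/3} ≤ ‖u(0)‖₂^{(4σ−6)/3} · ‖u(t)‖²_{Ḣ^σ}`
(`SuperLadder.superLadder_clock` read through `∑_j 4^{σj}‖Δ̇_j u‖₂² ≤ 8·4^σ ‖u‖²_{Ḣ^σ}`; `κ = κ_σ^{L54}/(8·4^σ)`). Its square
root `‖u(t)‖_{Ḣ^σ} ≥ √κ · ν^{σ/3} ‖u(0)‖₂^{(3−2σ)/3} (T − t)^{−σ/3}` is Benameur's bound AS PRINTED (there for `σ > 5/2`),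
here for every `σ > 3/2`. [cite: Benameur2010, Thm. 1.1] [cite: BahouriCheminDanchin2011, §2.3 (Ḃ^s_{2,2} = Ḣ^s)] -/
theorem homSobolev_superLadder_clock_sq (σ : ℝ) (hσ : 3 / 2 < σ) :
    ∃ κ : ℝ, 0 < κ ∧ ∀ (ν T : ℝ), 0 < ν → 0 < T →
      ∀ (u : ℝ → EuclideanSpace ℝ (Fin 3) → EuclideanSpace ℝ (Fin 3)) (p : ℝ → EuclideanSpace ℝ (Fin 3) → ℝ),
      IsMaximalSmoothSolution ν 0 u p T → IsLerayHopfOn T ν 0 (u 0) u →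
      ∀ t ∈ Ioo 0 T,
        ENNReal.ofReal (κ * ν ^ (2 * σ / 3) * (T - t) ^ (-(2 * σ / 3))) ≤
          eLpNorm (u 0) 2 volume ^ ((4 * σ - 6) / 3) *
            Function.eHomSobolevSeminorm σ (⇑EuclideanSpace.complexify ∘ u t) ^ 2 := by
  obtain ⟨κ, hκ, H⟩ := superLadder_clock σ hσ
  have hσ0 : 0 < σ := by linarith
  set M : ℝ := 8 * (2 : ℝ) ^ (2 * σ) with hM
  have hM0 : 0 < M := by positivity
  have hMe : (8 : ℝ≥0∞) * (2 : ℝ≥0∞) ^ |2 * σ| = ENNReal.ofReal M := by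
    rw [abs_of_pos (by linarith), hM, ENNReal.ofReal_mul (by norm_num), ← ENNReal.ofReal_rpow_of_pos two_pos,
      ENNReal.ofReal_ofNat, ENNReal.ofReal_ofNat]
  refine ⟨κ / M, by positivity, fun ν T hν hT u p hmax hLH t ht => ?_⟩
  have hTt : 0 < T - t := sub_pos.2 ht.2
  have hut : MemLp (u t) 2 volume := hLH.memLp t ⟨ht.1.le, ht.2.le⟩
  have h := H ν T hν hT u p hmax hLH t ht
  have hcmp := tsum_weight_blockL2_sq_le σ hut
  rw [hMe] at hcmp
  have h3 := h.trans (mul_le_mul_right hcmp (eLpNorm (u 0) 2 volume ^ ((4 * σ - 6) / 3)))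
  have e : κ / M * ν ^ (2 * σ / 3) * (T - t) ^ (-(2 * σ / 3)) =
      M⁻¹ * (κ * ν ^ (2 * σ / 3) * (T - t) ^ (-(2 * σ / 3))) := by
    field_simp
  rw [e, ENNReal.ofReal_mul (by positivity), ENNReal.ofReal_inv_of_pos hM0]
  have hMne : ENNReal.ofReal M ≠ 0 := by rwa [ne_eq, ENNReal.ofReal_eq_zero, not_le]
  calc (ENNReal.ofReal M)⁻¹ * ENNReal.ofReal (κ * ν ^ (2 * σ / 3) * (T - t) ^ (-(2 * σ / 3)))
      ≤ (ENNReal.ofReal M)⁻¹ * (eLpNorm (u 0) 2 volume ^ ((4 * σ - 6) / 3) *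
          (ENNReal.ofReal M * Function.eHomSobolevSeminorm σ (⇑EuclideanSpace.complexify ∘ u t) ^ 2)) :=
        mul_le_mul_right h3 _
    _ = eLpNorm (u 0) 2 volume ^ ((4 * σ - 6) / 3) *
          Function.eHomSobolevSeminorm σ (⇑EuclideanSpace.complexify ∘ u t) ^ 2 := by
        rw [mul_left_comm (eLpNorm (u 0) 2 volume ^ _), ← mul_assoc,
          ENNReal.inv_mul_cancel hMne ENNReal.ofReal_ne_top, one_mul]

/-- **`‖u(t)‖_{Ḣ^σ} → ∞` as `t ↑ T` for every `σ > 3/2`** along every maximal smooth Leray–Hopf solution of the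
unforced system (`ν > 0`): the energy factor `‖u(0)‖₂^{(4σ−6)/3}` is finite and the left side of
`homSobolev_superLadder_clock_sq` tends to `∞`. Together with L27′ (`s = 1/2`), L52′ (`1/2 < s < 3/2`) and L57′
(`s = 3/2`): `‖u(t)‖_{Ḣ^s} → ∞` at the lifespan for EVERY `s ≥ 1/2`. [cite: Benameur2010, Thm. 1.1] -/
theorem homSobolev_superLadder_tendsto_top (σ : ℝ) (hσ : 3 / 2 < σ) {ν T : ℝ} (hν : 0 < ν) (hT : 0 < T)
    {u : ℝ → EuclideanSpace ℝ (Fin 3) → EuclideanSpace ℝ (Fin 3)} {p : ℝ → EuclideanSpace ℝ (Fin 3) → ℝ}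
    (hmax : IsMaximalSmoothSolution ν 0 u p T) (hLH : IsLerayHopfOn T ν 0 (u 0) u) :
    Tendsto (fun t => Function.eHomSobolevSeminorm σ (⇑EuclideanSpace.complexify ∘ u t)) (𝓝[<] T) (𝓝 ∞) := by
  obtain ⟨κ, hκ, H⟩ := homSobolev_superLadder_clock_sq σ hσ
  have hσ0 : 0 < σ := by linarith
  have hu0 : MemLp (u 0) 2 volume := hLH.memLp 0 ⟨le_rfl, hT.le⟩
  set Ea : ℝ≥0∞ := eLpNorm (u 0) 2 volume ^ ((4 * σ - 6) / 3) with hEa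
  have hEatop : Ea ≠ ∞ := ENNReal.rpow_ne_top_of_nonneg (by linarith) hu0.eLpNorm_ne_top
  -- the squared seminorm tends to `∞`
  have hsq : Tendsto (fun t => Function.eHomSobolevSeminorm σ (⇑EuclideanSpace.complexify ∘ u t) ^ 2)
      (𝓝[<] T) (𝓝 ∞) := by
    have hclock := SobolevLadderFront.tendsto_ofReal_clock_top (a := 2 * σ / 3) (b := 2 * σ / 3) (T := T) hκ hν
      (by positivity)
    rw [ENNReal.tendsto_nhds_top_iff_nnreal] at hclock ⊢
    intro x
    have hx := hclock (x * Ea.toNNReal + 1)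
    filter_upwards [hx, Ioo_mem_nhdsLT hT] with t h1 ht
    have h2 := H ν T hν hT u p hmax hLH t ht
    -- `x · Ea + 1 < clock ≤ Ea · Y²` forces `x < Y²`
    by_contra hle
    push Not at hle
    have h3 : Ea * Function.eHomSobolevSeminorm σ (⇑EuclideanSpace.complexify ∘ u t) ^ 2 ≤ Ea * x :=
      mul_le_mul_right hle _
    have h4 : ((x * Ea.toNNReal + 1 : ℝ≥0) : ℝ≥0∞) ≤ Ea * x := (h1.le.trans h2).trans h3
    rw [ENNReal.coe_add, ENNReal.coe_mul, ENNReal.coe_toNNReal hEatop, ENNReal.coe_one, mul_comm] at h4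
    have h5 : Ea * x < Ea * x + 1 := ENNReal.lt_add_right (ENNReal.mul_ne_top hEatop ENNReal.coe_ne_top) one_ne_zero
    exact absurd h4 (not_le.2 h5)
  -- square root
  rw [ENNReal.tendsto_nhds_top_iff_nnreal] at hsq ⊢
  intro x
  filter_upwards [hsq (x ^ 2)] with t ht
  by_contra hle
  push Not at hle
  have : Function.eHomSobolevSeminorm σ (⇑EuclideanSpace.complexify ∘ u t) ^ 2 ≤ (x : ℝ≥0∞) ^ 2 :=
    pow_le_pow_left' hle 2
  rw [← ENNReal.coe_pow] at this
  exact absurd ht (not_lt.2 this)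

end Summit.NavierStokesRegularity.FluidComputer.HomSobolevSuperLadder

end
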